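import Summits.KontsevichZagierPeriods.Zeta5Search.LaiSweepShard

/-!
# `κ₃` sweep certificate — shard file 028 of 127 (shards 196–202 of 889)

HONEST FRAMING. Systematic search; no irrationality claim unless certified. This file only checks,
by `decide +kernel`, shards 196–202 of the order-cell sweep of the `κ₃` point `(74, 2180, 444; δ74)`
(engine `LaiSweepEngine`, soundness `LaiSweepJump/Free/Eval/Shard/Kappa3`; a shard is `⟨regime, n,
p, q, p', q', Lo, Up⟩`: `n` cells from `p/q` to `p'/q'` with integer rate sums in `[Lo, Up]`, `K =
128`, `D = 2^40`). It draws NO conclusion: only the capstone `LaiKappa3SweepCert`, which needs all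
127 shard files, does. Kernel cost of this file ≈ 560 cells × 0.3 s.
-/

namespace Summit.KontsevichZagierPeriods.Zeta5Search.Sweep

set_option maxHeartbeats 100000000 in
/-- Shard 196: 80 cells of regime B from `33/257` to `623/4804`.
[cite: Lai2024BallRivoal, §4 Lemma 4.3] -/
theorem shard196 :
    Shard.check 128 (2^40)
      ⟨true, 80, 33, 257, 623, 4804, 51223733267476, 51756113461521⟩ = true := by
  decide +kernel

set_option maxHeartbeats 100000000 in
/-- Shard 197: 80 cells of regime B from `623/4804` to `629/4804`.
[cite: Lai2024BallRivoal, §4 Lemma 4.3] -/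
theorem shard197 :
    Shard.check 128 (2^40)
      ⟨true, 80, 623, 4804, 629, 4804, 49420754771926, 49946788812878⟩ = true := by
  decide +kernel

set_option maxHeartbeats 100000000 in
/-- Shard 198: 80 cells of regime B from `629/4804` to `55/416`.
[cite: Lai2024BallRivoal, §4 Lemma 4.3] -/
theorem shard198 :
    Shard.check 128 (2^40)
      ⟨true, 80, 629, 4804, 55, 416, 50314661832667, 50860237551491⟩ = true := by
  decide +kernel

set_option maxHeartbeats 100000000 in
/-- Shard 199: 80 cells of regime B from `55/416` to `43/322`.
[cite: Lai2024BallRivoal, §4 Lemma 4.3] -/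
theorem shard199 :
    Shard.check 128 (2^40)
      ⟨true, 80, 55, 416, 43, 322, 51489230717808, 52064180561387⟩ = true := by
  decide +kernel

set_option maxHeartbeats 100000000 in
/-- Shard 200: 80 cells of regime B from `43/322` to `45/334`.
[cite: Lai2024BallRivoal, §4 Lemma 4.3] -/
theorem shard200 :
    Shard.check 128 (2^40)
      ⟨true, 80, 43, 322, 45, 334, 45999458873894, 46519541821149⟩ = true := by
  decide +kernel

set_option maxHeartbeats 100000000 in
/-- Shard 201: 80 cells of regime B from `45/334` to `48/353`.
[cite: Lai2024BallRivoal, §4 Lemma 4.3] -/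
theorem shard201 :
    Shard.check 128 (2^40)
      ⟨true, 80, 45, 334, 48, 353, 47480394952888, 48028997708479⟩ = true := by
  decide +kernel

set_option maxHeartbeats 100000000 in
/-- Shard 202: 80 cells of regime B from `48/353` to `7/51`.
[cite: Lai2024BallRivoal, §4 Lemma 4.3] -/
theorem shard202 :
    Shard.check 128 (2^40)
      ⟨true, 80, 48, 353, 7, 51, 48449224230533, 49023631312624⟩ = true := by
  decide +kernel

/-- The checked shards of this file, in order. [folklore] -/
def shards028 : List (CheckedShard 128 (2^40)) :=
  [⟨_, shard196⟩, ⟨_, shard197⟩, ⟨_, shard198⟩, ⟨_, shard199⟩, ⟨_, shard200⟩,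
    ⟨_, shard201⟩, ⟨_, shard202⟩]

end Summit.KontsevichZagierPeriods.Zeta5Search.Sweep
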